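import Literature.MathematicalPhysics.QuantumLattice.TorusSectorGibbsMixture
import Literature.MathematicalPhysics.QuantumLattice.GibbsVariationalPrinciple
import HarnessLib

/-!
# Free-energy windows ⇒ thermal energy windows for torus limits of canonical sector Gibbs states

Family `hubbard` (topic `MathematicalPhysics/QuantumLattice`; companion of `TorusSectorGibbsMixture` — the
*torus-limit thermal convention*: the equilibrium state of the `t–t'` Hubbard model at `(β, n)` is a torus
limit `ω` of the CANONICAL GIBBS STATES `ρ_{L,β} = e^{-βH_L}/Z` on the `(rectN n L, S^z = 0)` sector of the
`L × L` torus — and of `GibbsVariationalPrinciple` — the matrix thermal toolkit: Gibbs variational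
principle, `F ≤ E₀ ≤ E ≤ F + T S_max`, convexity chords of `β ↦ log Z_β`). Written for the `T > 0`
certificate family of the Hubbard cell (sr-mbsolver/hubbard-thermal, technique (ii) "free-energy two-sided
bounds"): it supplies the COMPOSITION «certified bounds on the sector free energy at ≤ 3 temperatures ⇒
certified two-sided window on the thermal energy density at fixed `T`», in the vocabulary the certificates
bind.

§1 `sectorHamiltonianTT' t t' U n L` — the compression `H_L(t,t',U)|_{(rectN n L, S^z=0)}` of the torus
Hamiltonian to the canonical sector (`Matrix.submatrix` along the sector configurations `szConfig n L`);
it is Hermitian, its partition function `Z_{L,β} = tr_{sector} e^{-βH_L}` is the sector sum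
`Σ_i e^{-βE_{L,i}}` over the mixture energies of `TorusSectorGibbsMixture`
(`partitionFn_sectorHamiltonianTT'`), and the Gibbs-state energy of the compression IS the mean energy of
the canonical Gibbs mixture (`re_gibbsState_sectorHamiltonianTT'`). Hence every matrix thermal statement
applies to the canonical sector Gibbs state verbatim; recorded by name: the Gibbs variational principle for
sector densities (`vonNeumannEntropy_sub_mul_le_log_partitionFn_sector` — the producer of free-energy
UPPER bounds = `log Z` LOWER bounds from trial states), the finite-volume chords
(`sectorGibbs_meanEnergy_le_chord`, `chord_le_sectorGibbs_meanEnergy`), `F ≤ E`, `E ≤ (log dim − log Z)/β`,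
`E₀ ≤ E`, and the antitonicity of the mean energy in `β`.
§2 passes to the thermodynamic limit along `Ls → ∞` for every torus limit `ω` of the sector Gibbs
mixtures at `β` (`IsTorusLimitOfMixture`, `tendsto_meanEnergy_hubbardTTPrime`): EVENTUAL per-volume bounds
`ℓ·L² ≤ log Z_{L,β}`, `log Z_{L,β_h} ≤ u_h·L²` (`0 < β_h < β`) give the **hot chord**
`e_Φ(ω) ≤ (u_h − ℓ)/(β − β_h)` (`…meanEnergy_hubbardTTPrime_le_chord_of_sectorGibbs`); `ℓ·L² ≤ log Z_{L,β}`,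
`log Z_{L,β_c} ≤ u_c·L²` (`β < β_c`) give the **cold chord** `(ℓ − u_c)/(β_c − β) ≤ e_Φ(ω)`
(`…chord_le_meanEnergy_hubbardTTPrime_of_sectorGibbs`); `ℓ·L² ≤ log Z_{L,β}` alone gives
`e_Φ(ω) ≤ (s − ℓ)/β` whenever `log #sector_L ≤ s·L²` eventually (`…le_entropy_sub_div_of_sectorGibbs`, the
infinite-temperature chord; with `ℓ = −β·(e₀ upper)` this is the kinematic cap of `TorusSectorGibbsMixture`);
and the packaged two-sided window with the CUT row `e(t,t',U,n) ≤ e_Φ(ω)`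
(`…meanEnergy_hubbardTTPrime_mem_Icc_chord_of_sectorGibbs`).
§3 the temperature axis: torus limits `ω₁, ω₂` of the sector Gibbs states at `β₁ ≤ β₂` along the SAME
tori satisfy `e_Φ(ω₂) ≤ e_Φ(ω₁)` (`…meanEnergy_hubbardTTPrime_anti_of_sectorGibbs`), so a window certified
at the two ends of a temperature interval holds for every torus limit at every temperature inside
(`…meanEnergy_hubbardTTPrime_window_on_interval_of_sectorGibbs`) — the form a phase-map cell over a
temperature RANGE consumes.

Everything is PROVED; one concrete definition (`sectorHamiltonianTT'`), no named fact. What the free-energy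
route can and cannot deliver at a given `(β_h, β)` is then a statement about the two input bounds only:
the chord's intrinsic slack is the mean excess energy `(β − β_h)⁻¹ ∫_{β_h}^{β} (e(β') − e(β)) dβ'`.

## References

* R. B. Israel, *Convexity in the Theory of Lattice Gases* (1979), Lemma II.3.1 (finite-volume variational
  principle, equality at the Gibbs state) and §I.3 eq. (26). [cite: Israel1979, Lemma II.3.1]
* D. Ruelle, *Statistical Mechanics: Rigorous Results* (1969), §2.5–2.6 (convexity of `log Z` in `β`,
  thermodynamic inequalities), §3.4. [cite: Ruelle1969, §2.5–2.6]
* S. J. Gustafson, I. M. Sigal, *Mathematical Concepts of Quantum Mechanics* (2003), §18.3 (18.12)–(18.13).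
  [cite: GustafsonSigal2003, §18.3]

## Mathlib / tree search

REUSED: `sectorEigenvalue`, `sectorGibbsIndex/Count/EnergyTT'/VectorTT'/WeightTT'`, `canonicalWeight`,
`re_expect_sectorGibbsVectorTT'`, `exists_szConfig`, `hubbardTorusTT'_isHermitian`,
`IsTorusLimitOfMixture.tendsto_meanEnergy_hubbardTTPrime`, `…energyDensityTT'_le_meanEnergy_of_sectorGibbs`,
`eventually_log_sectorGibbsCount_le` (`TorusSectorGibbsMixture`, `TorusLimitOfMixtures`); `Matrix.partitionFn_eq_sum_exp`,
`Matrix.IsHermitian.re_gibbsState_self`, and from `GibbsVariationalPrinciple` the chords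
`Matrix.IsHermitian.energy_le_chord/chord_le_energy`, `…neg_log_partitionFn_le_mul_energy`,
`…mul_energy_le_log_card_sub_log_partitionFn`, `…groundEnergy_le_re_gibbsState_self`,
`…re_gibbsState_self_antitone` (`GibbsEntropy`), `…vonNeumannEntropy_sub_mul_le_log_partitionFn`.
`lean search 'sectorHamiltonian|submatrix.*szConfig' --decl`: nothing.
-/

noncomputable section

namespace Literature.MathematicalPhysics.QuantumLattice

open Matrix Finset HubbardWave0 Literature.Probability.LatticeModels ThermodynamicLimit
open Literature.InformationTheory.Entropy
open _root_.Filter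
open scoped _root_.Topology ComplexOrder BigOperators

/-! ### §1 The canonical-sector compression of the torus Hamiltonian and its Gibbs data -/

section Sector

/-- The **canonical-sector Hamiltonian**: the compression of the `t–t'` torus Hamiltonian
`H_L(t,t',U) = hubbardTorusTT' L t t' U` to the coordinate sector `(N, S^z) = (rectN n L, 0)`
(configurations `szConfig n L`). Its Gibbs state at `β` is the canonical Gibbs state `ρ_{L,β}` of the
torus-limit thermal convention, its partition function the canonical partition function.
[cite: Israel1979, §I.3 eq. (26)] -/
def sectorHamiltonianTT' (t t' U n : ℝ) (L : ℕ) :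
    Matrix (Subtype (szConfig n L)) (Subtype (szConfig n L)) ℂ :=
  (hubbardTorusTT' L t t' U).submatrix Subtype.val Subtype.val

/-- The sector Hamiltonian is Hermitian. [cite: Israel1979, §I.3 eq. (26)] -/
theorem isHermitian_sectorHamiltonianTT' (t t' U n : ℝ) (L : ℕ) :
    (sectorHamiltonianTT' t t' U n L).IsHermitian :=
  (hubbardTorusTT'_isHermitian L t t' U).submatrix Subtype.val

/-- The sector is nonempty for `0 ≤ n ≤ 2`. [cite: LiebPRL1989, proof of Theorem 1] -/
theorem nonempty_szConfig {n : ℝ} (hn0 : 0 ≤ n) (hn2 : n ≤ 2) (L : ℕ) :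
    Nonempty (Subtype (szConfig n L)) := by
  obtain ⟨s, hs⟩ := exists_szConfig hn0 hn2 L
  exact ⟨⟨s, hs⟩⟩

/-- Decidable equality of sector configurations, recorded as an explicit instance assembled from the
ambient one on `Finset (Orb (FermionTorus 2 L))`: the default search finds exactly this term but it
exceeds `synthInstance.maxSize` (deep order-synonym chain `Finset (Lex (Lex (Fin 2 → Fin L) × Fin 2))`,
cf. `GaugedHubbardTorus.instDecidableEqIndex`); `Decidable` instances are subsingletons, so nothing is
overridden, and the term agrees definitionally with the one inside `sectorEigenvalue`. [folklore] -/
instance instDecidableEqSubtypeSzConfig (n : ℝ) (L : ℕ) : DecidableEq (Subtype (szConfig n L)) :=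
  @Subtype.instDecidableEq _ _ inferInstance

/-- The mixture energies are the eigenvalues of the sector Hamiltonian, read through the enumeration
`sectorGibbsIndex`. [cite: Tasaki2020, §2.2] -/
theorem sectorGibbsEnergyTT'_eq_eigenvalues (t t' U n : ℝ) (L : ℕ) (i : Fin (sectorGibbsCount n L)) :
    sectorGibbsEnergyTT' t t' U n L i =
      (isHermitian_sectorHamiltonianTT' t t' U n L).eigenvalues (sectorGibbsIndex n L i) :=
  rfl

/-- **The canonical partition function is the sector sum**: `Z_β(H_L|_{sector}) = Σ_i e^{-βE_{L,i}}`
over the energies of the canonical Gibbs mixture. [cite: Israel1979, Lemma II.3.1] -/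
theorem partitionFn_sectorHamiltonianTT' (β t t' U n : ℝ) (L : ℕ) :
    partitionFn β (sectorHamiltonianTT' t t' U n L) =
      ((∑ i, Real.exp (-(β * sectorGibbsEnergyTT' t t' U n L i)) : ℝ) : ℂ) := by
  rw [(isHermitian_sectorHamiltonianTT' t t' U n L).partitionFn_eq_ofReal,
    ← Equiv.sum_comp (sectorGibbsIndex n L)
      (fun a => Real.exp (-(β * (isHermitian_sectorHamiltonianTT' t t' U n L).eigenvalues a)))]
  rfl

/-- Real form: `Re Z_β(H_L|_{sector}) = Σ_i e^{-βE_{L,i}}`. [cite: Israel1979, Lemma II.3.1] -/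
theorem partitionFn_sectorHamiltonianTT'_re (β t t' U n : ℝ) (L : ℕ) :
    (partitionFn β (sectorHamiltonianTT' t t' U n L)).re =
      ∑ i, Real.exp (-(β * sectorGibbsEnergyTT' t t' U n L i)) := by
  rw [partitionFn_sectorHamiltonianTT', Complex.ofReal_re]

/-- **The Gibbs-state energy of the compression is the mean energy of the canonical Gibbs mixture**:
`Re⟨H_L|_s⟩_β = Σ_i p_{L,i}(β) Re⟨ψ_{L,i}, H_L ψ_{L,i}⟩`. [cite: Israel1979, Lemma II.3.1] -/
theorem re_gibbsState_sectorHamiltonianTT' (β t t' U n : ℝ) (L : ℕ) :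
    (gibbsState β (sectorHamiltonianTT' t t' U n L) (sectorHamiltonianTT' t t' U n L)).re =
      ∑ i, sectorGibbsWeightTT' β t t' U n L i *
        (expect (hubbardTorusTT' L t t' U) (sectorGibbsVectorTT' t t' U n L i)).re := by
  set hHs := isHermitian_sectorHamiltonianTT' t t' U n L with hHs_def
  set e := sectorGibbsIndex n L with he
  have h1 : ∑ j, Real.exp (-(β * sectorGibbsEnergyTT' t t' U n L j)) =
      ∑ a, Real.exp (-(β * hHs.eigenvalues a)) :=
    Equiv.sum_comp e (fun a => Real.exp (-(β * hHs.eigenvalues a)))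
  have h2 : ∑ j, Real.exp (-(β * sectorGibbsEnergyTT' t t' U n L j)) * sectorGibbsEnergyTT' t t' U n L j =
      ∑ a, Real.exp (-(β * hHs.eigenvalues a)) * hHs.eigenvalues a :=
    Equiv.sum_comp e (fun a => Real.exp (-(β * hHs.eigenvalues a)) * hHs.eigenvalues a)
  rw [hHs.re_gibbsState_self β, ← h1, ← h2, Finset.mul_sum]
  refine Finset.sum_congr rfl fun i _ => ?_
  rw [re_expect_sectorGibbsVectorTT', sectorGibbsWeightTT', canonicalWeight]
  ring

variable {n : ℝ}

/-- **Gibbs variational principle for the canonical sector** (producer of free-energy UPPER bounds):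
for every density matrix `ρ` on the sector and every real `β`,
`S(ρ) − β Re tr(ρ H_L|_s) ≤ log Z_{L,β}` (`Matrix.IsHermitian.vonNeumannEntropy_sub_mul_le_log_partitionFn`
for the compression). [cite: Israel1979, Lemma II.3.1] -/
theorem vonNeumannEntropy_sub_mul_le_log_partitionFn_sector (β t t' U n : ℝ) (L : ℕ)
    {ρ : Matrix (Subtype (szConfig n L)) (Subtype (szConfig n L)) ℂ} (hρ : ρ.PosSemidef)
    (htr : ρ.trace = 1) :
    vonNeumannEntropy ρ - β * (ρ * sectorHamiltonianTT' t t' U n L).trace.re ≤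
      Real.log (partitionFn β (sectorHamiltonianTT' t t' U n L)).re :=
  (isHermitian_sectorHamiltonianTT' t t' U n L).vonNeumannEntropy_sub_mul_le_log_partitionFn β hρ htr

/-- **Finite-volume hot chord**: for `0 < β_h < β` the mean energy of the canonical Gibbs state is at
most the chord of `log Z` from the hotter `β_h`:
`Σ_i p_{L,i}(β) E_{L,i} ≤ (log Z_{L,β_h} − log Z_{L,β})/(β − β_h)`. [cite: Ruelle1969, §2.5–2.6] -/
theorem sectorGibbs_meanEnergy_le_chord (hn0 : 0 ≤ n) (hn2 : n ≤ 2) (t t' U : ℝ) (L : ℕ)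
    {β βh : ℝ} (hβ : 0 < β) (hlt : βh < β) :
    ∑ i, sectorGibbsWeightTT' β t t' U n L i *
        (expect (hubbardTorusTT' L t t' U) (sectorGibbsVectorTT' t t' U n L i)).re ≤
      (Real.log (partitionFn βh (sectorHamiltonianTT' t t' U n L)).re -
        Real.log (partitionFn β (sectorHamiltonianTT' t t' U n L)).re) / (β - βh) := by
  haveI := nonempty_szConfig hn0 hn2 L
  rw [← re_gibbsState_sectorHamiltonianTT']
  exact (isHermitian_sectorHamiltonianTT' t t' U n L).energy_le_chord hβ hlt

/-- **Finite-volume cold chord**: for `0 < β < β_c`,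
`(log Z_{L,β} − log Z_{L,β_c})/(β_c − β) ≤ Σ_i p_{L,i}(β) E_{L,i}`. [cite: Ruelle1969, §2.5–2.6] -/
theorem chord_le_sectorGibbs_meanEnergy (hn0 : 0 ≤ n) (hn2 : n ≤ 2) (t t' U : ℝ) (L : ℕ)
    {β βc : ℝ} (hβ : 0 < β) (hlt : β < βc) :
    (Real.log (partitionFn β (sectorHamiltonianTT' t t' U n L)).re -
        Real.log (partitionFn βc (sectorHamiltonianTT' t t' U n L)).re) / (βc - β) ≤
      ∑ i, sectorGibbsWeightTT' β t t' U n L i *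
        (expect (hubbardTorusTT' L t t' U) (sectorGibbsVectorTT' t t' U n L i)).re := by
  haveI := nonempty_szConfig hn0 hn2 L
  rw [← re_gibbsState_sectorHamiltonianTT']
  exact (isHermitian_sectorHamiltonianTT' t t' U n L).chord_le_energy hβ hlt

/-- **`F ≤ E` in the sector**: `−log Z_{L,β} ≤ β · Σ_i p_{L,i}(β) E_{L,i}` (the canonical Gibbs state
has non-negative entropy; every real `β`). [cite: Ruelle1969, §2.5–2.6] -/
theorem neg_log_partitionFn_le_mul_sectorGibbs_meanEnergy (hn0 : 0 ≤ n) (hn2 : n ≤ 2)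
    (t t' U : ℝ) (L : ℕ) (β : ℝ) :
    -Real.log (partitionFn β (sectorHamiltonianTT' t t' U n L)).re ≤
      β * ∑ i, sectorGibbsWeightTT' β t t' U n L i *
        (expect (hubbardTorusTT' L t t' U) (sectorGibbsVectorTT' t t' U n L i)).re := by
  haveI := nonempty_szConfig hn0 hn2 L
  rw [← re_gibbsState_sectorHamiltonianTT']
  exact (isHermitian_sectorHamiltonianTT' t t' U n L).neg_log_partitionFn_le_mul_energy β

/-- **`E ≤ F + T S_max` in the sector**: `β · Σ_i p_{L,i}(β) E_{L,i} ≤ log #sector_L − log Z_{L,β}`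
(the infinite-temperature chord; `#sector_L = sectorGibbsCount n L`). [cite: Ruelle1969, §2.5–2.6] -/
theorem mul_sectorGibbs_meanEnergy_le_log_count_sub_log_partitionFn (hn0 : 0 ≤ n) (hn2 : n ≤ 2)
    (t t' U : ℝ) (L : ℕ) (β : ℝ) :
    β * ∑ i, sectorGibbsWeightTT' β t t' U n L i *
        (expect (hubbardTorusTT' L t t' U) (sectorGibbsVectorTT' t t' U n L i)).re ≤
      Real.log (sectorGibbsCount n L) - Real.log (partitionFn β (sectorHamiltonianTT' t t' U n L)).re := by
  haveI := nonempty_szConfig hn0 hn2 L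
  rw [← re_gibbsState_sectorHamiltonianTT']
  exact (isHermitian_sectorHamiltonianTT' t t' U n L).mul_energy_le_log_card_sub_log_partitionFn β

/-- **The mean energy of the canonical Gibbs state is antitone in `β`** (non-decreasing in the
temperature): `0 < β ≤ β'` gives `Σ_i p_{L,i}(β') E_{L,i} ≤ Σ_i p_{L,i}(β) E_{L,i}`.
[cite: Ruelle1969, §2.5–2.6] -/
theorem sectorGibbs_meanEnergy_anti (hn0 : 0 ≤ n) (hn2 : n ≤ 2) (t t' U : ℝ) (L : ℕ) {β β' : ℝ}
    (hβ : 0 < β) (hle : β ≤ β') :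
    ∑ i, sectorGibbsWeightTT' β' t t' U n L i *
        (expect (hubbardTorusTT' L t t' U) (sectorGibbsVectorTT' t t' U n L i)).re ≤
      ∑ i, sectorGibbsWeightTT' β t t' U n L i *
        (expect (hubbardTorusTT' L t t' U) (sectorGibbsVectorTT' t t' U n L i)).re := by
  haveI := nonempty_szConfig hn0 hn2 L
  rw [← re_gibbsState_sectorHamiltonianTT', ← re_gibbsState_sectorHamiltonianTT']
  exact (isHermitian_sectorHamiltonianTT' t t' U n L).re_gibbsState_self_antitone hβ hle

end Sector

/-! ### §2 Thermodynamic limit: chords of the sector free energy bound the thermal energy density -/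

namespace InfVolFermionState

variable {t t' U n β : ℝ} {ω : InfVolFermionState 2} {Ls : ℕ → ℕ}

/-- **Hot chord in the thermodynamic limit.** Let `ω` be a torus limit of the canonical sector Gibbs
states at `β` along `Ls → ∞` (`0 ≤ n ≤ 2`), and let `0 < β_h < β`. If eventually
`ℓ·L² ≤ log Z_{L,β}` (an upper bound `−ℓ/β` on the free energy per site at the target temperature, e.g.
from the Gibbs variational principle with trial states) and `log Z_{L,β_h} ≤ u_h·L²` (a lower bound on
the free energy per site at the hotter `β_h`), then `e_{Φ(t,t',U)}(ω) ≤ (u_h − ℓ)/(β − β_h)`.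
[cite: Ruelle1969, §2.5–2.6] [cite: Israel1979, Lemma II.3.1] -/
theorem IsTorusLimitOfMixture.meanEnergy_hubbardTTPrime_le_chord_of_sectorGibbs
    (hn0 : 0 ≤ n) (hn2 : n ≤ 2)
    (h : ω.IsTorusLimitOfMixture (sectorGibbsCount n) (fun L => sectorGibbsWeightTT' β t t' U n L)
      (fun L => sectorGibbsVectorTT' t t' U n L) Ls)
    (hLs : Tendsto Ls atTop atTop) {βh ℓ uh : ℝ} (hβh : 0 < βh) (hlt : βh < β)
    (hℓ : ∀ᶠ j in atTop, ℓ * (Ls j : ℝ) ^ 2 ≤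
      Real.log (partitionFn β (sectorHamiltonianTT' t t' U n (Ls j))).re)
    (huh : ∀ᶠ j in atTop, Real.log (partitionFn βh (sectorHamiltonianTT' t t' U n (Ls j))).re ≤
      uh * (Ls j : ℝ) ^ 2) :
    ω.meanEnergy (hubbardTTPrimeFermionInteraction t t' U) 1 ≤ (uh - ℓ) / (β - βh) := by
  have hβ : 0 < β := hβh.trans hlt
  refine le_of_tendsto (h.tendsto_meanEnergy_hubbardTTPrime t t' U hLs) ?_
  filter_upwards [hℓ, huh, hLs.eventually_ge_atTop 1] with j hl hu hj
  have hL2 : (0 : ℝ) < (Ls j : ℝ) ^ 2 := by positivity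
  have hch := sectorGibbs_meanEnergy_le_chord hn0 hn2 t t' U (Ls j) hβ hlt
  have hsum : ∑ i, sectorGibbsWeightTT' β t t' U n (Ls j) i *
      ((QuantumLattice.expect (hubbardTorusTT' (Ls j) t t' U) (sectorGibbsVectorTT' t t' U n (Ls j) i)).re /
        (Ls j : ℝ) ^ 2) =
      (∑ i, sectorGibbsWeightTT' β t t' U n (Ls j) i *
        (QuantumLattice.expect (hubbardTorusTT' (Ls j) t t' U) (sectorGibbsVectorTT' t t' U n (Ls j) i)).re) /
        (Ls j : ℝ) ^ 2 := by
    rw [Finset.sum_div]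
    exact Finset.sum_congr rfl fun i _ => by ring
  rw [hsum, div_le_iff₀ hL2]
  refine hch.trans ?_
  rw [div_mul_eq_mul_div, div_le_div_iff_of_pos_right (sub_pos.mpr hlt)]
  nlinarith

/-- **Cold chord in the thermodynamic limit.** With `ω`, `Ls`, `n` as above and `0 < β < β_c`: if
eventually `ℓ·L² ≤ log Z_{L,β}` and `log Z_{L,β_c} ≤ u_c·L²` (a lower bound on the free energy per site at
the COLDER `β_c`), then `(ℓ − u_c)/(β_c − β) ≤ e_{Φ(t,t',U)}(ω)`. [cite: Ruelle1969, §2.5–2.6]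
[cite: Israel1979, Lemma II.3.1] -/
theorem IsTorusLimitOfMixture.chord_le_meanEnergy_hubbardTTPrime_of_sectorGibbs
    (hn0 : 0 ≤ n) (hn2 : n ≤ 2)
    (h : ω.IsTorusLimitOfMixture (sectorGibbsCount n) (fun L => sectorGibbsWeightTT' β t t' U n L)
      (fun L => sectorGibbsVectorTT' t t' U n L) Ls)
    (hLs : Tendsto Ls atTop atTop) {βc ℓ uc : ℝ} (hβ : 0 < β) (hlt : β < βc)
    (hℓ : ∀ᶠ j in atTop, ℓ * (Ls j : ℝ) ^ 2 ≤
      Real.log (partitionFn β (sectorHamiltonianTT' t t' U n (Ls j))).re)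
    (huc : ∀ᶠ j in atTop, Real.log (partitionFn βc (sectorHamiltonianTT' t t' U n (Ls j))).re ≤
      uc * (Ls j : ℝ) ^ 2) :
    (ℓ - uc) / (βc - β) ≤ ω.meanEnergy (hubbardTTPrimeFermionInteraction t t' U) 1 := by
  refine ge_of_tendsto (h.tendsto_meanEnergy_hubbardTTPrime t t' U hLs) ?_
  filter_upwards [hℓ, huc, hLs.eventually_ge_atTop 1] with j hl hu hj
  have hL2 : (0 : ℝ) < (Ls j : ℝ) ^ 2 := by positivity
  have hch := chord_le_sectorGibbs_meanEnergy hn0 hn2 t t' U (Ls j) hβ hlt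
  have hsum : ∑ i, sectorGibbsWeightTT' β t t' U n (Ls j) i *
      ((QuantumLattice.expect (hubbardTorusTT' (Ls j) t t' U) (sectorGibbsVectorTT' t t' U n (Ls j) i)).re /
        (Ls j : ℝ) ^ 2) =
      (∑ i, sectorGibbsWeightTT' β t t' U n (Ls j) i *
        (QuantumLattice.expect (hubbardTorusTT' (Ls j) t t' U) (sectorGibbsVectorTT' t t' U n (Ls j) i)).re) /
        (Ls j : ℝ) ^ 2 := by
    rw [Finset.sum_div]
    exact Finset.sum_congr rfl fun i _ => by ring
  rw [hsum, le_div_iff₀ hL2]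
  refine le_trans ?_ hch
  rw [div_mul_eq_mul_div, div_le_div_iff_of_pos_right (sub_pos.mpr hlt)]
  nlinarith

/-- **The infinite-temperature chord in the thermodynamic limit** (`F`-upper bound alone): if eventually
`ℓ·L² ≤ log Z_{L,β}` and `log #sector_L ≤ s·L²` (`β > 0`), then `e_{Φ(t,t',U)}(ω) ≤ (s − ℓ)/β`. With
`ℓ = −β × (an upper bound on e₀)` this is the kinematic cap of `TorusSectorGibbsMixture`; every better
free-energy upper bound at `β` (a trial state with entropy) lowers it. [cite: Israel1979, Lemma II.3.1]
[cite: Ruelle1969, §2.5–2.6] -/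
theorem IsTorusLimitOfMixture.meanEnergy_hubbardTTPrime_le_entropy_sub_div_of_sectorGibbs
    (hn0 : 0 ≤ n) (hn2 : n ≤ 2)
    (h : ω.IsTorusLimitOfMixture (sectorGibbsCount n) (fun L => sectorGibbsWeightTT' β t t' U n L)
      (fun L => sectorGibbsVectorTT' t t' U n L) Ls)
    (hLs : Tendsto Ls atTop atTop) (hβ : 0 < β) {ℓ s : ℝ}
    (hℓ : ∀ᶠ j in atTop, ℓ * (Ls j : ℝ) ^ 2 ≤
      Real.log (partitionFn β (sectorHamiltonianTT' t t' U n (Ls j))).re)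
    (hs : ∀ᶠ j in atTop, Real.log (sectorGibbsCount n (Ls j)) ≤ s * (Ls j : ℝ) ^ 2) :
    ω.meanEnergy (hubbardTTPrimeFermionInteraction t t' U) 1 ≤ (s - ℓ) / β := by
  refine le_of_tendsto (h.tendsto_meanEnergy_hubbardTTPrime t t' U hLs) ?_
  filter_upwards [hℓ, hs, hLs.eventually_ge_atTop 1] with j hl hsj hj
  have hL2 : (0 : ℝ) < (Ls j : ℝ) ^ 2 := by positivity
  have hcap := mul_sectorGibbs_meanEnergy_le_log_count_sub_log_partitionFn hn0 hn2 t t' U (Ls j) β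
  have hsum : ∑ i, sectorGibbsWeightTT' β t t' U n (Ls j) i *
      ((QuantumLattice.expect (hubbardTorusTT' (Ls j) t t' U) (sectorGibbsVectorTT' t t' U n (Ls j) i)).re /
        (Ls j : ℝ) ^ 2) =
      (∑ i, sectorGibbsWeightTT' β t t' U n (Ls j) i *
        (QuantumLattice.expect (hubbardTorusTT' (Ls j) t t' U) (sectorGibbsVectorTT' t t' U n (Ls j) i)).re) /
        (Ls j : ℝ) ^ 2 := by
    rw [Finset.sum_div]
    exact Finset.sum_congr rfl fun i _ => by ring
  rw [hsum, div_le_iff₀ hL2, div_mul_eq_mul_div, le_div_iff₀ hβ, mul_comm _ β]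
  nlinarith

/-- **Two-sided thermal energy window from the cut row and a hot chord** (`0 < β_h < β`, `U ≥ 0`,
`0 ≤ n < 2`): `e(t,t',U,n) ≤ e_{Φ(t,t',U)}(ω) ≤ (u_h − ℓ)/(β − β_h)` for every torus limit `ω` of the
canonical sector Gibbs states at `β`, given the eventual free-energy bounds `ℓ·L² ≤ log Z_{L,β}` and
`log Z_{L,β_h} ≤ u_h·L²`. The lower edge is the variational (cut) row of `TorusSectorGibbsMixture`; any
certified lower bound on `e(t,t',U,n)` may be substituted. [cite: Ruelle1969, §2.5–2.6, §3.4]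
[cite: Israel1979, Lemma II.3.1] -/
theorem IsTorusLimitOfMixture.meanEnergy_hubbardTTPrime_mem_Icc_chord_of_sectorGibbs
    {U : ℝ} (hU : 0 ≤ U) (hn0 : 0 ≤ n) (hn2 : n < 2)
    (h : ω.IsTorusLimitOfMixture (sectorGibbsCount n) (fun L => sectorGibbsWeightTT' β t t' U n L)
      (fun L => sectorGibbsVectorTT' t t' U n L) Ls)
    (hLs : Tendsto Ls atTop atTop) {βh ℓ uh : ℝ} (hβh : 0 < βh) (hlt : βh < β)
    (hℓ : ∀ᶠ j in atTop, ℓ * (Ls j : ℝ) ^ 2 ≤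
      Real.log (partitionFn β (sectorHamiltonianTT' t t' U n (Ls j))).re)
    (huh : ∀ᶠ j in atTop, Real.log (partitionFn βh (sectorHamiltonianTT' t t' U n (Ls j))).re ≤
      uh * (Ls j : ℝ) ^ 2) :
    ω.meanEnergy (hubbardTTPrimeFermionInteraction t t' U) 1 ∈
      Set.Icc (energyDensityTT' t t' U n) ((uh - ℓ) / (β - βh)) :=
  ⟨h.energyDensityTT'_le_meanEnergy_of_sectorGibbs t t' U hn0 hn2 β hLs t' hU,
   h.meanEnergy_hubbardTTPrime_le_chord_of_sectorGibbs hn0 hn2.le hLs hβh hlt hℓ huh⟩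

/-! ### §3 The temperature axis: monotonicity and windows on a temperature interval -/

/-- **The thermal energy density is antitone in `β` along a common sequence of tori**: if `ω₁`, `ω₂`
are torus limits of the canonical sector Gibbs states at `0 < β₁ ≤ β₂` along the SAME `Ls → ∞`, then
`e_Φ(ω₂) ≤ e_Φ(ω₁)` (finite-volume antitonicity, `sectorGibbs_meanEnergy_anti`, and the two limits).
[cite: Ruelle1969, §2.5–2.6] -/
theorem IsTorusLimitOfMixture.meanEnergy_hubbardTTPrime_anti_of_sectorGibbs
    (hn0 : 0 ≤ n) (hn2 : n ≤ 2) {β₁ β₂ : ℝ} (hβ₁ : 0 < β₁) (hle : β₁ ≤ β₂)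
    {ω₁ ω₂ : InfVolFermionState 2}
    (h₁ : ω₁.IsTorusLimitOfMixture (sectorGibbsCount n) (fun L => sectorGibbsWeightTT' β₁ t t' U n L)
      (fun L => sectorGibbsVectorTT' t t' U n L) Ls)
    (h₂ : ω₂.IsTorusLimitOfMixture (sectorGibbsCount n) (fun L => sectorGibbsWeightTT' β₂ t t' U n L)
      (fun L => sectorGibbsVectorTT' t t' U n L) Ls)
    (hLs : Tendsto Ls atTop atTop) :
    ω₂.meanEnergy (hubbardTTPrimeFermionInteraction t t' U) 1 ≤
      ω₁.meanEnergy (hubbardTTPrimeFermionInteraction t t' U) 1 := by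
  refine le_of_tendsto_of_tendsto (h₂.tendsto_meanEnergy_hubbardTTPrime t t' U hLs)
    (h₁.tendsto_meanEnergy_hubbardTTPrime t t' U hLs) ?_
  filter_upwards [hLs.eventually_ge_atTop 1] with j hj
  have hL2 : (0 : ℝ) < (Ls j : ℝ) ^ 2 := by positivity
  have hmono := sectorGibbs_meanEnergy_anti hn0 hn2 t t' U (Ls j) hβ₁ hle
  have hsum : ∀ b : ℝ, ∑ i, sectorGibbsWeightTT' b t t' U n (Ls j) i *
      ((QuantumLattice.expect (hubbardTorusTT' (Ls j) t t' U) (sectorGibbsVectorTT' t t' U n (Ls j) i)).re /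
        (Ls j : ℝ) ^ 2) =
      (∑ i, sectorGibbsWeightTT' b t t' U n (Ls j) i *
        (QuantumLattice.expect (hubbardTorusTT' (Ls j) t t' U) (sectorGibbsVectorTT' t t' U n (Ls j) i)).re) /
        (Ls j : ℝ) ^ 2 := by
    intro b
    rw [Finset.sum_div]
    exact Finset.sum_congr rfl fun i _ => by ring
  simp only [hsum]
  exact div_le_div_of_nonneg_right hmono hL2.le

/-- **A thermal energy window on a temperature INTERVAL.** Along a common `Ls → ∞`, let `ω₁` be a torus
limit of the canonical sector Gibbs states at the hot end `β₁`, `ω₂` at the cold end `β₂`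
(`0 < β₁ ≤ β₂`), with a certified lower bound `lo ≤ e_Φ(ω₂)` and upper bound `e_Φ(ω₁) ≤ hi`. Then EVERY
torus limit `ω` (same `Ls`) of the sector Gibbs states at any `β ∈ [β₁, β₂]` satisfies
`lo ≤ e_Φ(ω) ≤ hi`. [cite: Ruelle1969, §2.5–2.6] -/
theorem IsTorusLimitOfMixture.meanEnergy_hubbardTTPrime_window_on_interval_of_sectorGibbs
    (hn0 : 0 ≤ n) (hn2 : n ≤ 2) {β₁ β₂ lo hi : ℝ} (hβ₁ : 0 < β₁)
    {ω₁ ω₂ : InfVolFermionState 2}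
    (h₁ : ω₁.IsTorusLimitOfMixture (sectorGibbsCount n) (fun L => sectorGibbsWeightTT' β₁ t t' U n L)
      (fun L => sectorGibbsVectorTT' t t' U n L) Ls)
    (h₂ : ω₂.IsTorusLimitOfMixture (sectorGibbsCount n) (fun L => sectorGibbsWeightTT' β₂ t t' U n L)
      (fun L => sectorGibbsVectorTT' t t' U n L) Ls)
    (hLs : Tendsto Ls atTop atTop)
    (hlo : lo ≤ ω₂.meanEnergy (hubbardTTPrimeFermionInteraction t t' U) 1)
    (hhi : ω₁.meanEnergy (hubbardTTPrimeFermionInteraction t t' U) 1 ≤ hi)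
    (hβ : β₁ ≤ β) (hβ' : β ≤ β₂)
    (h : ω.IsTorusLimitOfMixture (sectorGibbsCount n) (fun L => sectorGibbsWeightTT' β t t' U n L)
      (fun L => sectorGibbsVectorTT' t t' U n L) Ls) :
    lo ≤ ω.meanEnergy (hubbardTTPrimeFermionInteraction t t' U) 1 ∧
      ω.meanEnergy (hubbardTTPrimeFermionInteraction t t' U) 1 ≤ hi :=
  ⟨hlo.trans (h.meanEnergy_hubbardTTPrime_anti_of_sectorGibbs hn0 hn2 (hβ₁.trans_le hβ) hβ' h₂ hLs),
   (h₁.meanEnergy_hubbardTTPrime_anti_of_sectorGibbs hn0 hn2 hβ₁ hβ h hLs).trans hhi⟩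

end InfVolFermionState

end Literature.MathematicalPhysics.QuantumLattice
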